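import Summits.CriticalPhenomena.PercolationContinuityZ3.Theorems.Transplant.SkelFrmBParamsFaceCountsRangeA
import Summits.CriticalPhenomena.PercolationContinuityZ3.Theorems.Transplant.SkelFrmBParamsFaceRunA
import Summits.CriticalPhenomena.PercolationContinuityZ3.Theorems.Transplant.SkelFrmBChoiceNums
import Summits.CriticalPhenomena.PercolationContinuityZ3.Theorems.Transplant.PlanarSkeletonFrmDefs
import Summits.CriticalPhenomena.PercolationContinuityZ3.Theorems.Transplant.SkelPhiStepIDataNS
import HarnessLib
/-!
(F) VALUE LAYER, N2 twin (hp-8 g42, 2026-08-23; F-DISCHARGE-MAP-N2 G18): `port_frm.py` text of N1 `SkelNegBParamsFaceFloorsFitXA` (p3-g12) over the N2 counts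
(`…FaceCountsRangeA`, generic staggered cells `(P : PCells2T) (hP : …)`, creep-aware `σTX … du`) and `…FaceRunA` (`hfitX_RA/hq₃X_RA` at `KS0.R'0`): `hfit_XA`, `hq₃_XA`.
NON-VACUITY: arithmetic under `EqNumL`, the provider's level hypotheses and the n_L floor `2000·Kq·(R'0+2) ≤ n_L`.
builds on p205010 (kernel theorem, internal audit signed; external expert review pending); nothing here is a claim about the open node `SamePDropOfSkeletonFrm₁`.
N1 HEADER (kept for the reader):
# N1 params, M3 group G-fit — **THE x-FACE CROSS-LINK ROOMS `hfit`, `hq₃`** at the (ζ′) tuple, pinned at the M3 skeleton's choice functions: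
# `qB + (NrX+1)·RA′ ≤ n_L` (one added served hypothesis `4·qB ≤ n_L` on the generic start half-width; G-O's `qBXF?` values meet it) and
# `W + (NrX+1)·RA′ + 2 ≤ qB3XA (RA′ mk)` — both `hfitX_RA`/`hq₃X_RA` (FaceRunA, stmt-g16) ∘ `NrX_range`/`PlanarSkeletonNeg.NegB.KS.counts_budget` (RangeA)
(p3-g12, M3 pen, 2026-08-22; fields `FloorsX2.hfit/hq₃` (SkelPhiFaceNumsXP2 :83–:84) at M3-FLOORS-SIGNATURE §1).
builds on p205010 (kernel theorem, internal audit signed; external expert review pending) — nothing in this file uses p205010; NOTHING is claimed about the node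
`SamePDropOfSkeletonNeg₁` (OPEN); arithmetic only.
Lane `prim-bschramm-*`, seat `prim-bschramm-p3` (gen 12); helper file (`--supports stmt-CriticalPhenomena-4575 --as helper`).
[cite: KozmaNitzan2024, §4 Lemma 12 (pp. 23–25)]
-/

noncomputable section

open scoped Classical

namespace Summit.CriticalPhenomena.PercolationContinuityZ3.Theorems.Transplant

namespace PlanarSkeletonFrm

namespace NegB

open Literature.Probability.Percolation Literature.Probability.LatticeModels SimpleGraph
open Literature.Probability.Percolation.KozmaNitzan.Cells (oth sgOf sgOf_sign)
open SkelConc (Consts)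
open Skelφ (shearUnit)
open Skelφ.StepI (DataN)
open TwoAxis.Para (modulus)
open Neg

namespace KS

section Fit

/-- **`hfit` pinned** at the M3 skeleton's choice functions (added served hypothesis `hq4 : 4·qB ≤ n_L`). [folklore] -/
theorem hfit_XA (κ : Consts) {V : Type} [DecidableEq V] [Countable V] {G : SimpleGraph V} [G.LocallyFinite] (Φ : PlanarSkeletonFrm G) (t : V) (p : unitInterval) (D : Skelφ.StepI.DataNS V) (mk : ℕ) (g : ℕ) (f : ℕ) (P : PCells2T) (hP : P.toPCells2 = fcellsA κ Φ t p D g f) (hN : EqNumL κ Φ t p D g f)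
    (hnA : 2000 * Neg.Kq κ * (KS0.R'0 κ Φ t p D mk + 2) ≤ nL κ Φ t p D g f)
    (x : Site 2) (du : MDir) (hd : du.1 = 0) (j : ℕ) (hj : j < P.K) (z : Site 2) {E : ℕ}
    (hlev1 : P.faceL 0 j - E ≤ P.lev du x z) (hlev2 : P.lev du x z ≤ P.faceL 0 j + E)
    (hEu : (E : ℤ) ≤ u₀A κ Φ t p D g f)
    (yL : Site 2) (he0 : |FcA κ Φ t p D g f (yTX0 κ Φ t p D g f yL (σTX κ Φ t p D g f P yL x du z))| ≤ 6 * u₀A κ Φ t p D g f) (qB : ℕ)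
    (hq4 : 4 * qB ≤ nL κ Φ t p D g f) :
    (qB : ℤ) + (((NrX κ Φ t p D g f P yL (σTX κ Φ t p D g f P yL x du z) x du z) : ℤ) + 1) * (KS0.R'0 κ Φ t p D mk) ≤ (nL κ Φ t p D g f)  := by
  obtain ⟨-, hNr⟩ := NrX_range κ Φ t p D g f P hP hN x du hd z hj hlev1 hlev2 yL (σTX κ Φ t p D g f P yL x du z) he0
    (by linarith [(units_eqA κ Φ t p D g f).2.2.2.2.1])
  obtain ⟨hNr', -, -⟩ := PlanarSkeletonNeg.NegB.KS.counts_budget κ (N₃ := 0) hNr (by have := Neg.one_le_Kq κ; omega)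
  exact hfitX_RA κ Φ t p D g f mk hq4 le_rfl hNr' hnA

/-- **`hq₃` pinned** at the M3 skeleton's choice functions. [folklore] -/
theorem hq₃_XA (κ : Consts) {V : Type} [DecidableEq V] [Countable V] {G : SimpleGraph V} [G.LocallyFinite] (Φ : PlanarSkeletonFrm G) (t : V) (p : unitInterval) (D : Skelφ.StepI.DataNS V) (mk : ℕ) (g : ℕ) (f : ℕ) (P : PCells2T) (hP : P.toPCells2 = fcellsA κ Φ t p D g f) (hN : EqNumL κ Φ t p D g f)
    (x : Site 2) (du : MDir) (hd : du.1 = 0) (j : ℕ) (hj : j < P.K) (z : Site 2) {E : ℕ}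
    (hlev1 : P.faceL 0 j - E ≤ P.lev du x z) (hlev2 : P.lev du x z ≤ P.faceL 0 j + E)
    (hEu : (E : ℤ) ≤ u₀A κ Φ t p D g f)
    (yL : Site 2) (he0 : |FcA κ Φ t p D g f (yTX0 κ Φ t p D g f yL (σTX κ Φ t p D g f P yL x du z))| ≤ 6 * u₀A κ Φ t p D g f) :
    (((nL κ Φ t p D g f) * (ℓL κ Φ t p D g f) / shearUnit (nL κ Φ t p D g f) (prFA κ Φ t p D g f).h + 1 : ℕ) : ℤ) + (((NrX κ Φ t p D g f P yL (σTX κ Φ t p D g f P yL x du z) x du z) : ℤ) + 1) * (KS0.R'0 κ Φ t p D mk) + 2 ≤ (qB3XA κ Φ t p D g f (KS0.R'0 κ Φ t p D mk))  := by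
  obtain ⟨-, hNr⟩ := NrX_range κ Φ t p D g f P hP hN x du hd z hj hlev1 hlev2 yL (σTX κ Φ t p D g f P yL x du z) he0
    (by linarith [(units_eqA κ Φ t p D g f).2.2.2.2.1])
  obtain ⟨hNr', -, -⟩ := PlanarSkeletonNeg.NegB.KS.counts_budget κ (N₃ := 0) hNr (by have := Neg.one_le_Kq κ; omega)
  exact hq₃X_RA κ Φ t p D g f (KS0.R'0 κ Φ t p D mk) hNr'

end Fit

end KS

end NegB

end PlanarSkeletonFrm

end Summit.CriticalPhenomena.PercolationContinuityZ3.Theorems.Transplant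

end
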